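import Literature.Probability.MarkovChains.HarmonicIntegratorEnergyError
import Literature.Probability.MarkovChains.MultipleTimeScaleIntegrator
import HarnessLib

/-!
# The two-stage splitting integrators `(a₁, ½, 1 − 2a₁, ½, a₁)` on the harmonic oscillator:
# `ρ(h) = h⁴(2a₁²(½ − a₁)h² + 4a₁² − 6a₁ + 1)² / (8(2 − a₁h²)(2 − (½ − a₁)h²)(1 − a₁(½ − a₁)h²))`
# (Blanes–Casas–Sanz-Serna 2014, §6.1 eq. (rhodos)); the swapped integrator; Sexton–Weingarten `a₁ = 1/6`

S. Blanes, F. Casas, J. M. Sanz-Serna, *Numerical integrators for the Hybrid Monte Carlo method*,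
SIAM J. Sci. Comput. 36 (2014) A1556–A1580 [BlanesCasasSanzserna2014] = arXiv:1405.3153 (held text
`paper:arxiv-1405.3153`), §5 (p0011) and §6.1 (p0013):

> (§5) … palindromic compositions such as `ψ_h = φ^A_{a₁h} ∘ φ^B_{b₁h} ∘ φ^A_{a₂h} ∘ φ^B_{b₂h} ∘ φ^A_{a₂h}
> ∘ φ^B_{b₁h} ∘ φ^A_{a₁h}` [`A = ½pᵀM⁻¹p` the kinetic, `B = V(q)` the potential energy, §2] … we
> shall use the symbols `(a₁, b₁, a₂, …, b₁, a₁)` …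
> (§6.1) **Two-stage methods: `(a₁, b₁, a₂, b₁, a₁)`.** Consistent integrators have to satisfy
> `b₁ = 1/2`, `a₂ = 1 − 2a₁` and this leaves the one-parameter family (eq:family)
> `(a₁, 1/2, 1 − 2a₁, 1/2, a₁)`. The choices `a₁ = 0` and `a₁ = 1/2` are singular; for them the
> integrator reduces to the velocity Verlet and position Verlet algorithm respectively. Furthermore
> for `a₁ = 1/4` one time-step `ψ_h` of (family) coincides with the concatenation
> `ψ^{PosVer}_{h/2} ∘ ψ^{PosVer}_{h/2}` … We first find from (ander)
> (eq:rhodos) `ρ(h) = h⁴(2a₁²(1/2 − a₁)h² + 4a₁² − 6a₁ + 1)² /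
> (8(2 − a₁h²)(2 − (1/2 − a₁)h²)(1 − a₁(1/2 − a₁)h²))`.
> Stability is equivalent to the positivity of the denominator. Note that for `a₁ = 0` or `a₁ = 1/2`
> the quotient (rhodos) reduces to (rhoverlet), as it should. … useful methods have `0 < a₁ < 1/2`. In
> this parameter range, the stability interval is (eq:stabfamily)
> `0 < h < min{√(2/a₁), √(2/(1/2 − a₁))}`, provided that `a₁ ≠ 1/4`. When `a₁ = 1/4` … the fraction
> reduces to (rhoverlet) with `h` replaced by `h/2` and the stability interval is `0 < h < 4` …

and §4.1, Remark before §4.2 (p0009):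

> … `M̃_h = [[A_h, −C_h], [−B_h, D_h]]` is a second integrator of the same order of accuracy. The
> integrators … share the same interval of stability and the same `θ_h`. The function `χ_h` of (swap)
> is obtained by changing the sign of the reciprocal of the function `χ_h` … Accordingly, [they] share
> a common `ρ(h)`. The velocity Verlet algorithm and the position Verlet algorithm provide an example
> of this kind of pair of integrators.

C. Urbach, K. Jansen, A. Shindler, U. Wenger [UrbachEtAl2006], §2.2 eq. (15) (the Sexton–Weingarten
scheme, formalised on general phase space in `MultipleTimeScaleIntegrator.lean`):
`T_{SW₀} = T_{S₀}(Δτ₀/6) T_U(Δτ₀/2) T_{S₀}(2Δτ₀/3) T_U(Δτ₀/2) T_{S₀}(Δτ₀/6)` — the KICK-outside member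
`a₁ = 1/6` of the swapped family (`MultipleTimeScaleIntegrator.lean` records "nothing about
discretization errors (the O(Δτ²) cancellations motivating the SW coefficients 1/6, 2/3, 1/6)").

Sequel to `HarmonicIntegratorEnergyError.lean` (`HOScheme`, `rho`, `rho_eq`, `integral_deltaH_le_rho`,
`verlet` REUSED).  This file PROVES (everything a theorem; small definitions with bodies; no named
facts), for the harmonic oscillator `H = ½(p² + q²)`:
* `driftHO`, `kickHO` — the exact flows `φ^A_t : (q,p) ↦ (q + tp, p)`, `φ^B_t : (q,p) ↦ (q, p − tq)`;
* `HOScheme.swap` (`(A, B, C) ↦ (A, −C, −B)`) with **`swap_rho`** (the swapped integrator has the same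
  `ρ`) and `swap_swap`; `posVerlet h = (verlet h).swap`, `posVerlet_step` (= `φ^A_{h/2} φ^B_h φ^A_{h/2}`);
* `twoStage a₁ h : HOScheme` — the family (eq:family), with **`twoStage_step`** (its step IS the
  composition `φ^A_{a₁h} ∘ φ^B_{h/2} ∘ φ^A_{(1−2a₁)h} ∘ φ^B_{h/2} ∘ φ^A_{a₁h}`), `twoStage_zero`
  (`= verlet h`), `twoStage_half` (`= posVerlet h`), **`twoStage_quarter_step`**
  (`a₁ = 1/4`: `= ψ^{PosVer}_{h/2} ∘ ψ^{PosVer}_{h/2}`);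
* `twoStage_one_sub_A_sq` (`1 − A_h² = (h²/4)(2 − a₁h²)(2 − (½ − a₁)h²)(1 − a₁(½ − a₁)h²)`),
  `twoStage_B_add_C`, **`twoStage_stable_iff`** ("stability is equivalent to the positivity of the
  denominator", precisely: `|A_h| < 1 ↔ 0 < h²·(2 − a₁h²)(2 − (½ − a₁)h²)(1 − a₁(½ − a₁)h²)`),
  **`twoStage_stable_of_lt`** ((eq:stabfamily): `0 < a₁ < ½`, `0 < h² < min{2/a₁, 2/(½ − a₁)}` ⟹
  stable);
* **`twoStage_rho`** — (eq:rhodos); `twoStage_quarter_rho` (`a₁ = 1/4`: `ρ = (h/2)⁴/(32(1 − (h/2)²/4))`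
  on `0 < h² < 16`, `h² ≠ 8`); `twoStage_integral_deltaH_le` (`E(Δ) ≤ (rhodos)` for Gaussian initial data);
* `twoStageV a₁ h = (twoStage a₁ h).swap` — the kick-outside family `(b₁, a₁, b₂, a₁, b₁)` with
  `b₁ = a₁`-parameter, `twoStageV_step` (= `φ^B_{a₁h} φ^A_{h/2} φ^B_{(1−2a₁)h} φ^A_{h/2} φ^B_{a₁h}`),
  `twoStageV_rho` (same (rhodos)); **`swIntegrator_zero_unitForce`** — the tree's Sexton–Weingarten map
  `T_{SW₀}` for the unit-frequency linear force acts componentwise as `(twoStageV (1/6) Δτ₀).step`, and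
  **`sw_rho`**: its `ρ(h) = h⁴(h² + 6)² / (2916 · 8(2 − h²/6)(2 − h²/3)(1 − h²/18))`.

Scope (honest): unit harmonic oscillator only; the BCH coefficients `k_{3,1}, k_{3,2}`, McLachlan's
`a₁ ≈ 0.1932`, the minimiser `a₁ = 0.21178…` of `‖ρ‖_(2)` and the optimal-stability bound `h_max ≤ 2r`
(§4.4/§5, a Chebyshev-polynomial argument) are NOT formalised.

## References
* [BlanesCasasSanzserna2014] S. Blanes, F. Casas, J. M. Sanz-Serna, SIAM J. Sci. Comput. 36 (4)
  (2014) A1556–A1580, doi:10.1137/130932740, arXiv:1405.3153 — §4.1 Remark (swapped integrator), §5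
  eqs. (comp3)–(comp6), §6.1 eqs. (family), (rhodos), (stabfamily) and the `a₁ = 0, 1/2, 1/4` remarks
  (held text p0009, p0011, p0013).
* [UrbachEtAl2006] C. Urbach, K. Jansen, A. Shindler, U. Wenger, Comput. Phys. Commun. 174 (2006) 87,
  §2.2 eq. (15).
-/

noncomputable section

open MeasureTheory

namespace Literature.Probability.MarkovChains.HMC.Harmonic

/-! ### §1 The exact sub-flows and the swapped integrator -/

/-- The kinetic flow `φ^A_t : (q, p) ↦ (q + tp, p)` of `A = ½p²`. [cite: BlanesCasasSanzserna2014, §2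
(φ^A_t: "q(t) = q(0) + tM⁻¹p(0), p(t) = p(0)")] -/
def driftHO (t : ℝ) (v : ℝ × ℝ) : ℝ × ℝ := (v.1 + t * v.2, v.2)

/-- The potential flow `φ^B_t : (q, p) ↦ (q, p − tq)` of `B = V(q) = ½q²`.
[cite: BlanesCasasSanzserna2014, §2 (φ^B_t: "p(t) = p(0) − t∇V(q(0))")] -/
def kickHO (t : ℝ) (v : ℝ × ℝ) : ℝ × ℝ := (v.1, v.2 - t * v.1)

/-- Unfolding `φ^A_t`. [cite: BlanesCasasSanzserna2014, §2 (φ^A_t)] -/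
@[simp] theorem driftHO_apply (t : ℝ) (v : ℝ × ℝ) : driftHO t v = (v.1 + t * v.2, v.2) := rfl

/-- Unfolding `φ^B_t`. [cite: BlanesCasasSanzserna2014, §2 (φ^B_t)] -/
@[simp] theorem kickHO_apply (t : ℝ) (v : ℝ × ℝ) : kickHO t v = (v.1, v.2 - t * v.1) := rfl

namespace HOScheme

/-- **The swapped integrator** `[[A_h, −C_h], [−B_h, A_h]]` ("the roles of `q` and `p` and those of
the potential and kinetic energies … replaced"). [cite: BlanesCasasSanzserna2014, §4.1 Remark,
eq. (harmonicintegratorswap)] -/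
def swap (S : HOScheme) : HOScheme where
  A := S.A
  B := -S.C
  C := -S.B
  det_eq := by linear_combination S.det_eq

/-- The swap keeps `A_h`. [cite: BlanesCasasSanzserna2014, §4.1 Remark] -/
@[simp] theorem swap_A (S : HOScheme) : S.swap.A = S.A := rfl

/-- The swap's `B` entry is `−C_h`. [cite: BlanesCasasSanzserna2014, §4.1 Remark] -/
@[simp] theorem swap_B (S : HOScheme) : S.swap.B = -S.C := rfl

/-- The swap's `C` entry is `−B_h`. [cite: BlanesCasasSanzserna2014, §4.1 Remark] -/
@[simp] theorem swap_C (S : HOScheme) : S.swap.C = -S.B := rfl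

/-- Swapping twice is the identity. [cite: BlanesCasasSanzserna2014, §4.1 Remark] -/
theorem swap_swap (S : HOScheme) : S.swap.swap = S := by
  cases S
  simp [swap]

/-- The swapped integrator has the same `θ_h` ("share … the same θ_h").
[cite: BlanesCasasSanzserna2014, §4.1 Remark] -/
theorem swap_theta (S : HOScheme) : S.swap.theta = S.theta := rfl

/-- **The swapped integrator has the same `ρ(h)`** ("Accordingly, (harmonicintegrator) and
(harmonicintegratorswap) share a common ρ(h)"). [cite: BlanesCasasSanzserna2014, §4.1 Remark] -/
theorem swap_rho (S : HOScheme) (hA : |S.A| < 1) : S.swap.rho = S.rho := by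
  rw [S.swap.rho_eq hA, S.rho_eq hA]
  simp only [swap_A, swap_B, swap_C]
  ring

end HOScheme

/-- **Position Verlet** `ψ_h = φ^A_{h/2} ∘ φ^B_h ∘ φ^A_{h/2}` on the harmonic oscillator — the swap of
velocity Verlet: `A_h = 1 − h²/2`, `B_h = h − h³/4`, `C_h = −h`. [cite: BlanesCasasSanzserna2014, §2
eq. (comp2) and §4.1 Remark ("The velocity Verlet algorithm and the position Verlet algorithm provide
an example of this kind of pair")] -/
def posVerlet (h : ℝ) : HOScheme := (verlet h).swap

/-- Position Verlet IS `φ^A_{h/2} ∘ φ^B_h ∘ φ^A_{h/2}`. [cite: BlanesCasasSanzserna2014, §2 eq. (comp2)] -/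
theorem posVerlet_step (h : ℝ) (v : ℝ × ℝ) :
    (posVerlet h).step v = driftHO (h / 2) (kickHO h (driftHO (h / 2) v)) := by
  refine Prod.ext ?_ ?_
  · simp [posVerlet, HOScheme.swap, HOScheme.step, verlet]
    ring
  · simp [posVerlet, HOScheme.swap, HOScheme.step, verlet]
    ring

/-- Velocity Verlet IS `φ^B_{h/2} ∘ φ^A_h ∘ φ^B_{h/2}`. [cite: BlanesCasasSanzserna2014, §2 eq. (comp1)] -/
theorem verlet_step (h : ℝ) (v : ℝ × ℝ) :
    (verlet h).step v = kickHO (h / 2) (driftHO h (kickHO (h / 2) v)) := by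
  refine Prod.ext ?_ ?_
  · simp [HOScheme.step, verlet]
    ring
  · simp [HOScheme.step, verlet]
    ring

/-! ### §2 The family `(a₁, ½, 1 − 2a₁, ½, a₁)` -/

/-- **The two-stage family (eq:family)** `(a₁, 1/2, 1 − 2a₁, 1/2, a₁)` on the harmonic oscillator:
`A_h = 1 − h²/2 + a₁(½ − a₁)h⁴/2`, `B_h = h − a₁(1 − a₁)h³ + a₁²(1 − 2a₁)h⁵/4`,
`C_h = −h + (1 − 2a₁)h³/4` (the product of the five shears, `twoStage_step`).
[cite: BlanesCasasSanzserna2014, §6.1 eq. (family)] -/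
def twoStage (a h : ℝ) : HOScheme where
  A := 1 - h ^ 2 / 2 + a * (1 / 2 - a) * h ^ 4 / 2
  B := h - a * (1 - a) * h ^ 3 + a ^ 2 * (1 - 2 * a) * h ^ 5 / 4
  C := -h + (1 - 2 * a) * h ^ 3 / 4
  det_eq := by ring

/-- **The family IS the composition** `φ^A_{a₁h} ∘ φ^B_{h/2} ∘ φ^A_{(1−2a₁)h} ∘ φ^B_{h/2} ∘ φ^A_{a₁h}`.
[cite: BlanesCasasSanzserna2014, §5 eq. (comp4)/(comp6) and §6.1 eq. (family)] -/
theorem twoStage_step (a h : ℝ) (v : ℝ × ℝ) :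
    (twoStage a h).step v =
      driftHO (a * h) (kickHO (h / 2) (driftHO ((1 - 2 * a) * h)
        (kickHO (h / 2) (driftHO (a * h) v)))) := by
  refine Prod.ext ?_ ?_
  · simp [HOScheme.step, twoStage]
    ring
  · simp [HOScheme.step, twoStage]
    ring

/-- `a₁ = 0`: the velocity Verlet algorithm. [cite: BlanesCasasSanzserna2014, §6.1 ("The choices
a₁ = 0 and a₁ = 1/2 are singular; … velocity Verlet and position Verlet")] -/
theorem twoStage_zero (h : ℝ) : twoStage 0 h = verlet h := by
  simp only [twoStage, verlet]
  congr 1 <;> ring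

/-- `a₁ = 1/2`: the position Verlet algorithm. [cite: BlanesCasasSanzserna2014, §6.1] -/
theorem twoStage_half (h : ℝ) : twoStage (1 / 2) h = posVerlet h := by
  simp only [twoStage, posVerlet, verlet, HOScheme.swap]
  congr 1 <;> ring

/-- **`a₁ = 1/4`: one step is two position-Verlet steps of length `h/2`.**
[cite: BlanesCasasSanzserna2014, §6.1 ("for a₁ = 1/4 one time-step ψ_h of (family) coincides with
the concatenation ψ^{PosVer}_{h/2} ∘ ψ^{PosVer}_{h/2}")] -/
theorem twoStage_quarter_step (h : ℝ) (v : ℝ × ℝ) :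
    (twoStage (1 / 4) h).step v = (posVerlet (h / 2)).step ((posVerlet (h / 2)).step v) := by
  rw [posVerlet_step, posVerlet_step, twoStage_step]
  refine Prod.ext ?_ ?_
  · simp
    ring
  · simp
    ring

/-- `1 − A_h² = (h²/4)(2 − a₁h²)(2 − (½ − a₁)h²)(1 − a₁(½ − a₁)h²)` — the denominator of (rhodos).
[cite: BlanesCasasSanzserna2014, §6.1 eq. (rhodos)] -/
theorem twoStage_one_sub_A_sq (a h : ℝ) :
    1 - (twoStage a h).A ^ 2 =
      h ^ 2 / 4 * ((2 - a * h ^ 2) * (2 - (1 / 2 - a) * h ^ 2) * (1 - a * (1 / 2 - a) * h ^ 2)) := by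
  simp only [twoStage]
  ring

/-- `B_h + C_h = (h³/4)(2a₁²(½ − a₁)h² + 4a₁² − 6a₁ + 1)` — the numerator of (rhodos).
[cite: BlanesCasasSanzserna2014, §6.1 eq. (rhodos)] -/
theorem twoStage_B_add_C (a h : ℝ) :
    (twoStage a h).B + (twoStage a h).C =
      h ^ 3 / 4 * (2 * a ^ 2 * (1 / 2 - a) * h ^ 2 + 4 * a ^ 2 - 6 * a + 1) := by
  simp only [twoStage]
  ring

/-- **"Stability is equivalent to the positivity of the denominator"** (precisely: together with
`h ≠ 0`): `|A_h| < 1 ↔ 0 < h²(2 − a₁h²)(2 − (½ − a₁)h²)(1 − a₁(½ − a₁)h²)`.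
[cite: BlanesCasasSanzserna2014, §6.1 (sentence after (rhodos))] -/
theorem twoStage_stable_iff (a h : ℝ) :
    |(twoStage a h).A| < 1 ↔
      0 < h ^ 2 * ((2 - a * h ^ 2) * (2 - (1 / 2 - a) * h ^ 2) * (1 - a * (1 / 2 - a) * h ^ 2)) := by
  have key := twoStage_one_sub_A_sq a h
  constructor
  · intro hA
    have h1 : (twoStage a h).A ^ 2 < 1 := by
      have := abs_lt.mp hA
      nlinarith
    nlinarith [key]
  · intro hpos
    have h1 : (twoStage a h).A ^ 2 < 1 := by nlinarith [key]
    exact abs_lt.mpr ⟨by nlinarith, by nlinarith⟩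

/-- **(eq:stabfamily)**: for `0 < a₁ < ½` the method is stable whenever
`0 < h² < min{2/a₁, 2/(½ − a₁)}`. [cite: BlanesCasasSanzserna2014, §6.1 eq. (stabfamily)] -/
theorem twoStage_stable_of_lt {a h : ℝ} (ha0 : 0 < a) (ha1 : a < 1 / 2) (hh0 : 0 < h ^ 2)
    (hh1 : h ^ 2 < 2 / a) (hh2 : h ^ 2 < 2 / (1 / 2 - a)) : |(twoStage a h).A| < 1 := by
  rw [twoStage_stable_iff]
  have ha1' : 0 < 1 / 2 - a := by linarith
  have f1 : 0 < 2 - a * h ^ 2 := by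
    have := (lt_div_iff₀ ha0).mp hh1
    linarith
  have f2 : 0 < 2 - (1 / 2 - a) * h ^ 2 := by
    have := (lt_div_iff₀ ha1').mp hh2
    linarith
  -- `a(½ − a) ≤ 1/16` and `h² < 8`, so the third factor exceeds `1/2`
  have f3 : 0 < 1 - a * (1 / 2 - a) * h ^ 2 := by
    have hprod : a * (1 / 2 - a) ≤ 1 / 16 := by nlinarith [sq_nonneg (a - 1 / 4)]
    have h8 : h ^ 2 < 8 := by
      rcases le_or_gt a (1 / 4) with hle | hgt
      · -- `½ − a ≥ 1/4`, so `2/(½ − a) ≤ 8`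
        have : 2 / (1 / 2 - a) ≤ 8 := by
          rw [div_le_iff₀ ha1']
          linarith
        linarith
      · have : 2 / a ≤ 8 := by
          rw [div_le_iff₀ ha0]
          linarith
        linarith
    nlinarith [mul_nonneg (mul_nonneg ha0.le ha1'.le) hh0.le]
  positivity

/-- **(eq:rhodos)**: for stable `h`,
`ρ(h) = h⁴(2a₁²(½ − a₁)h² + 4a₁² − 6a₁ + 1)² / (8(2 − a₁h²)(2 − (½ − a₁)h²)(1 − a₁(½ − a₁)h²))`.
[cite: BlanesCasasSanzserna2014, §6.1 eq. (rhodos)] -/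
theorem twoStage_rho {a h : ℝ} (hA : |(twoStage a h).A| < 1) :
    (twoStage a h).rho =
      h ^ 4 * (2 * a ^ 2 * (1 / 2 - a) * h ^ 2 + 4 * a ^ 2 - 6 * a + 1) ^ 2 /
        (8 * ((2 - a * h ^ 2) * (2 - (1 / 2 - a) * h ^ 2) * (1 - a * (1 / 2 - a) * h ^ 2))) := by
  have hpos := (twoStage_stable_iff a h).mp hA
  have hh : h ^ 2 ≠ 0 := by
    intro h0
    rw [h0, zero_mul] at hpos
    exact lt_irrefl _ hpos
  have hP : (2 - a * h ^ 2) * (2 - (1 / 2 - a) * h ^ 2) * (1 - a * (1 / 2 - a) * h ^ 2) ≠ 0 := by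
    intro h0
    rw [h0, mul_zero] at hpos
    exact lt_irrefl _ hpos
  rw [(twoStage a h).rho_eq hA, twoStage_B_add_C, twoStage_one_sub_A_sq]
  rw [div_eq_div_iff (mul_ne_zero two_ne_zero (mul_ne_zero (div_ne_zero hh (by norm_num)) hP))
    (mul_ne_zero (by norm_num) hP)]
  ring

/-- **`E(Δ) ≤ ρ(h)` for the two-stage family** with Gaussian (Boltzmann) initial data, every number
of steps `I`. [cite: BlanesCasasSanzserna2014, §4.1 Proposition 3 with §6.1 eq. (rhodos)] -/
theorem twoStage_integral_deltaH_le {a h : ℝ} (hA : |(twoStage a h).A| < 1) (I : ℕ) :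
    ∫ v, (twoStage a h).deltaH I v ∂HOScheme.gaussInit ≤
      h ^ 4 * (2 * a ^ 2 * (1 / 2 - a) * h ^ 2 + 4 * a ^ 2 - 6 * a + 1) ^ 2 /
        (8 * ((2 - a * h ^ 2) * (2 - (1 / 2 - a) * h ^ 2) * (1 - a * (1 / 2 - a) * h ^ 2))) := by
  rw [← twoStage_rho hA]
  exact (twoStage a h).integral_deltaH_le_rho hA I

/-- **`a₁ = 1/4`: (rhodos) "reduces to (rhoverlet) with `h` replaced by `h/2` and the stability
interval is `0 < h < 4`".**  (At `h² = 8` one has `M̃_h = −I`, `|A_h| = 1` — the borderline "stable"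
case `A_h = ±1, B_h = C_h = 0` of §4.1 — which the strict criterion `|A_h| < 1` used here excludes.)
[cite: BlanesCasasSanzserna2014, §6.1 (the a₁ = 1/4 paragraph)] -/
theorem twoStage_quarter_rho {h : ℝ} (h0 : 0 < h ^ 2) (h16 : h ^ 2 < 16) (h8 : h ^ 2 ≠ 8) :
    |(twoStage (1 / 4) h).A| < 1 ∧
      (twoStage (1 / 4) h).rho = (h / 2) ^ 4 / (32 * (1 - (h / 2) ^ 2 / 4)) := by
  have f1 : 2 - 1 / 4 * h ^ 2 ≠ 0 := by
    intro h'
    apply h8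
    linarith
  have f2 : 2 - (1 / 2 - 1 / 4) * h ^ 2 ≠ 0 := by
    intro h'
    apply h8
    linarith
  have f3 : 0 < 1 - 1 / 4 * (1 / 2 - 1 / 4) * h ^ 2 := by linarith
  have hA : |(twoStage (1 / 4) h).A| < 1 := by
    rw [twoStage_stable_iff]
    have h12 : 0 < (2 - 1 / 4 * h ^ 2) * (2 - (1 / 2 - 1 / 4) * h ^ 2) := by
      have e : 2 - (1 / 2 - 1 / 4) * h ^ 2 = 2 - 1 / 4 * h ^ 2 := by ring
      rw [e]
      exact mul_self_pos.mpr f1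
    positivity
  refine ⟨hA, ?_⟩
  rw [twoStage_rho hA]
  have hne : 1 - (h / 2) ^ 2 / 4 ≠ 0 := by
    intro h'
    nlinarith
  rw [div_eq_div_iff (mul_ne_zero (by norm_num) (mul_ne_zero (mul_ne_zero f1 f2) f3.ne'))
    (mul_ne_zero (by norm_num) hne)]
  ring

/-! ### §3 The kick-outside family `(b₁, a₁, b₂, a₁, b₁)` and the Sexton–Weingarten scheme -/

/-- **The swapped family**: kicks outside, `φ^B_{a₁h} ∘ φ^A_{h/2} ∘ φ^B_{(1−2a₁)h} ∘ φ^A_{h/2} ∘ φ^B_{a₁h}`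
(`(b₁, a₁, b₂, a₁, b₁)` of (comp3)/(comp5) with `b₁ = a₁`-parameter, `a₁ = ½`, `b₂ = 1 − 2b₁`).
[cite: BlanesCasasSanzserna2014, §5 eq. (comp3)/(comp5) and §4.1 Remark] -/
def twoStageV (a h : ℝ) : HOScheme := (twoStage a h).swap

/-- The kick-outside family IS the composition `φ^B_{a₁h} φ^A_{h/2} φ^B_{(1−2a₁)h} φ^A_{h/2} φ^B_{a₁h}`.
[cite: BlanesCasasSanzserna2014, §5 eq. (comp3)/(comp5)] -/
theorem twoStageV_step (a h : ℝ) (v : ℝ × ℝ) :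
    (twoStageV a h).step v =
      kickHO (a * h) (driftHO (h / 2) (kickHO ((1 - 2 * a) * h)
        (driftHO (h / 2) (kickHO (a * h) v)))) := by
  refine Prod.ext ?_ ?_
  · simp [HOScheme.step, twoStageV, twoStage, HOScheme.swap]
    ring
  · simp [HOScheme.step, twoStageV, twoStage, HOScheme.swap]
    ring

/-- The kick-outside family is stable exactly when the drift-outside family is.
[cite: BlanesCasasSanzserna2014, §4.1 Remark ("share the same interval of stability")] -/
theorem twoStageV_A (a h : ℝ) : (twoStageV a h).A = (twoStage a h).A := rfl

/-- **(eq:rhodos) for the kick-outside family** (same `ρ`). [cite: BlanesCasasSanzserna2014, §6.1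
eq. (rhodos) with §4.1 Remark] -/
theorem twoStageV_rho {a h : ℝ} (hA : |(twoStage a h).A| < 1) :
    (twoStageV a h).rho =
      h ^ 4 * (2 * a ^ 2 * (1 / 2 - a) * h ^ 2 + 4 * a ^ 2 - 6 * a + 1) ^ 2 /
        (8 * ((2 - a * h ^ 2) * (2 - (1 / 2 - a) * h ^ 2) * (1 - a * (1 / 2 - a) * h ^ 2))) := by
  rw [twoStageV, (twoStage a h).swap_rho hA, twoStage_rho hA]

/-- **The Sexton–Weingarten scheme `T_{SW₀}` (kicks `Δτ/6, 2Δτ/3, Δτ/6`, drifts `Δτ/2, Δτ/2`) is the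
member `a₁ = 1/6` of the kick-outside family**, for the unit-frequency linear force `F(φ) = −φ`:
componentwise, the tree's `swIntegrator` at level `0` acts as `(twoStageV (1/6) Δτ₀).step`.
[cite: UrbachEtAl2006, §2.2 eq. (15)], [cite: BlanesCasasSanzserna2014, §6.1 eq. (family)] -/
theorem swIntegrator_zero_unitForce {ι : Type*} (dτ : ℕ → ℝ) (N : ℕ → ℕ) (x : PhaseSpace ι) (i : ι) :
    ((swIntegrator (fun _ => linearForce (fun _ : ι => (1 : ℝ))) dτ N 0 x).1 i,
      (swIntegrator (fun _ => linearForce (fun _ : ι => (1 : ℝ))) dτ N 0 x).2 i) =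
      (twoStageV (1 / 6) (dτ 0)).step (x.1 i, x.2 i) := by
  rw [twoStageV_step, swIntegrator_zero]
  simp only [Function.comp_apply, kick, drift, linearForce, Pi.add_apply, Pi.smul_apply, smul_eq_mul,
    kickHO_apply, driftHO_apply, one_pow, one_mul]
  refine Prod.ext ?_ ?_
  · ring
  · ring

/-- **`ρ(h)` of the Sexton–Weingarten scheme** (`a₁ = 1/6` in (rhodos)):
`ρ_SW(h) = h⁴(h²/54 + 1/9)² / (8(2 − h²/6)(2 − h²/3)(1 − h²/18))`, for stable `h`
(e.g. `0 < h² < 6`, `twoStage_stable_of_lt`). [cite: BlanesCasasSanzserna2014, §6.1 eq. (rhodos)],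
[cite: UrbachEtAl2006, §2.2 eq. (15)] -/
theorem sw_rho {h : ℝ} (hA : |(twoStage (1 / 6) h).A| < 1) :
    (twoStageV (1 / 6) h).rho =
      h ^ 4 * (h ^ 2 / 54 + 1 / 9) ^ 2 / (8 * ((2 - h ^ 2 / 6) * (2 - h ^ 2 / 3) * (1 - h ^ 2 / 18))) := by
  rw [twoStageV_rho hA]
  congr 1
  · ring
  · ring

/-- The Sexton–Weingarten scheme on the unit oscillator is stable for `0 < h² < 6`.
[cite: BlanesCasasSanzserna2014, §6.1 eq. (stabfamily) with a₁ = 1/6] -/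
theorem sw_stable {h : ℝ} (h0 : 0 < h ^ 2) (h6 : h ^ 2 < 6) : |(twoStage (1 / 6) h).A| < 1 :=
  twoStage_stable_of_lt (by norm_num) (by norm_num) h0 (by norm_num; linarith) (by norm_num; linarith)

/-- **`E(Δ) ≤ ρ_SW(h)`** for the Sexton–Weingarten scheme on the unit oscillator with Gaussian initial
data, `0 < h² < 6`, every number of steps `I`. [cite: BlanesCasasSanzserna2014, §4.1 Proposition 3
and §6.1 eq. (rhodos)], [cite: UrbachEtAl2006, §2.2 eq. (15)] -/
theorem sw_integral_deltaH_le {h : ℝ} (h0 : 0 < h ^ 2) (h6 : h ^ 2 < 6) (I : ℕ) :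
    ∫ v, (twoStageV (1 / 6) h).deltaH I v ∂HOScheme.gaussInit ≤
      h ^ 4 * (h ^ 2 / 54 + 1 / 9) ^ 2 / (8 * ((2 - h ^ 2 / 6) * (2 - h ^ 2 / 3) * (1 - h ^ 2 / 18))) := by
  have hA := sw_stable h0 h6
  rw [← sw_rho hA]
  exact (twoStageV (1 / 6) h).integral_deltaH_le_rho hA I

end Literature.Probability.MarkovChains.HMC.Harmonic

end
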